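import Summits.ValiantsHypothesis.ValiantsHypothesis.Theses.UnpaddedGIT
import Summits.ValiantsHypothesis.ValiantsHypothesis.Theorems.UnpaddedGITCompleteness
import Literature.Computability.AlgebraicComplexity.EquivariantDC
import Literature.Computability.AlgebraicComplexity.PermanentIrreducible
import Literature.Computability.AlgebraicComplexity.PolystabilityProofs
import Literature.RepresentationTheory.AlgebraicGroups.MumfordSeparationProofs

/-!
# Route UnpaddedGIT — typed decomposition of the deciding crux `InvariantSeparationQP`
(item stmt-ValiantsHypothesis-5758; strategist split, BC2 redirect; v2 — two-sided torus)

The deciding crux `X = InvariantSeparationQP` (an `SL_(n²)`-invariant on degree-`n` forms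
vanishing on the pencil-coefficient family `D_m(n)`, `m ≤ 2^((log₂ n + c)^c)`, and not at `per_n`)
is at least as strong as the summit. By the PROVED support item `Completeness`
(`completeness_proof`) together with the two PROVED GIT inputs — polystability of `per_n`
(`BurgisserIkenmeyer2017_polystable_det_per_holds`, BI17 Cor. 2.9) and Mumford separation for
`SL_(n²)` on forms (`MumfordFogartyKirwan1994_separation_forms_holds`, GIT Ch. 1 §2 Cor. 1.2) —
`X` follows from the geometric separation `per_n ∉ Zar(coeffVec '' D_m(n))`, and that separation
is cut here along the Landsberg–Ressayre seam "lower bound assuming symmetry + symmetrization"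
(LR 2017 = arXiv:1508.05788: Thm. 2.8, Question 2.2, Cor. 2.3), transported to the border /
pencil-coefficient setting of this route and to the TWO-SIDED TORUS `x_kl ↦ d_k e_l x_kl` (the
group of `RigidityForcesSymmetry.TorusBound`; no Weyl group):

* **Piece 1, `SliceTorusSymmetrizationQP`** (structural; border torus form of LR17 Question 2.2
  on the whole `ℂ[S_n]`-weight slice): every permutation-supported form `f = Σ_σ c_σ x^σ` — these
  are exactly the semi-invariants of the two-sided torus with the permanent's character — that is
  a limit of size-`m` pencil coefficients, `m ≤ qp(n)`, is a limit of polynomials with a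
  two-sided-torus-EQUIVARIANT affine determinantal representation (`IsEquivariantDetRepr`, exact
  `GL × GL` lifts) of size `qp'(n)`, uniformly in `f`.
* **Piece 2, `TorusEquivariantBorderQP`** (border + quasi-polynomial form of the exact crux
  `TorusBound` of routes RigidityForcesSymmetry / RigidMinimalReps, i.e. of LR17 Thm. 2.8 minus
  the Weyl group): for all large `n` and `m ≤ qp(n)`, `per_n` is not such a limit.

Why the torus and not LR's left monomial group: the tree's ABSTRACT count
`two_pow_sub_one_le_finrank` (LRWeightCount) with von zur Gathen's Lemma 3.2 makes every regular
left-equivariant representation of ANY polynomial exponential (`Σ_j Π_i x_ij`, of pencil size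
`n²`, has all its representations regular since its singular locus has codimension `2n ≥ 5`), so a
left-symmetrization piece would be the crux in costume; the torus-graded model is not generically
weak (`det_n`: size `n`; cyclic-shift sums and bounded-treewidth permanents: polynomial).

`invariantSeparationQP_of_pieces : Piece 1 → Piece 2 → X` is the assembly (the permanent is
permutation-supported, `exists_permMonomial_eq_of_coeff_perPoly_ne_zero`; modus tollens in the
window; then Mumford–GIT completeness with its two inputs discharged by tree theorems).
`leftover` bookkeeping: `not_mem_zariskiClosure_pencil_of_invariantSeparationQP` (the crux gives
the geometric separation) and `torusEquivariantBorderQP_of_invariantSeparationQP` (Piece 2 is a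
CONSEQUENCE of the crux, by restricting the separating invariant to the degree-`n` coordinates);
Piece 1 is not a consequence of the crux (it speaks about every slice form), and neither piece
alone is known to give the crux or the summit.

References: Landsberg–Ressayre 2017 (arXiv:1508.05788) Question 2.2, Cor. 2.3, Thm. 2.8, Lemma 3.2;
Mumford–Fogarty–Kirwan 1994 Ch. 1 §2 Cor. 1.2; Bürgisser–Ikenmeyer 2017 (arXiv:1511.02927) Cor. 2.9;
von zur Gathen 1987.
-/

-- single-conjunct layout: Sub = Summit, duplicated namespace component intended
set_option linter.dupNamespace false

namespace Summit.ValiantsHypothesis.ValiantsHypothesis.Theorems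

open MvPolynomial Literature.Computability.AlgebraicComplexity
open Literature.RepresentationTheory.AlgebraicGroups

/-- The permanent is permutation-supported: every exponent vector in its support is a permutation
monomial `Σ_i e_(ρ i, i)`. [folklore] -/
theorem perPoly_support_perm (n : ℕ) :
    ∀ s ∈ (perPoly (Fin n) ℂ).support, ∃ ρ : Equiv.Perm (Fin n), s = ∑ i, Finsupp.single (ρ i, i) 1 := by
  intro s hs
  obtain ⟨ρ, hρ⟩ := exists_permMonomial_eq_of_coeff_perPoly_ne_zero ℂ (mem_support_iff.1 hs)
  exact ⟨ρ, by rw [← hρ]; rfl⟩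

/-- **Assembly of the split** `SliceTorusSymmetrizationQP → TorusEquivariantBorderQP →
InvariantSeparationQP` (the two hypotheses are written literally; they are the children filed on
the route). Given `c`, Piece 1 yields `c'`; beyond both thresholds, for `m ≤ 2^((log₂ n + c)^c)`,
membership of `per_n` (a permutation-supported form) in the closure of `coeffVec '' D_m(n)` would
put it in the closure of the torus-equivariant family of some size `m' ≤ 2^((log₂ n + c')^c')`,
which Piece 2 forbids; the resulting geometric separation is turned into the separating
`SL_(n²)`-invariant by `completeness_proof`, whose polystability and Mumford hypotheses are the
tree theorems `BurgisserIkenmeyer2017_polystable_det_per_holds` and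
`MumfordFogartyKirwan1994_separation_forms_holds`. [cite: LandsbergRessayre2017, Question 2.2, Cor. 2.3, Thm. 2.8] -/
theorem invariantSeparationQP_of_pieces
    (hSym : ∀ c : ℕ, ∃ c' n₀ : ℕ, ∀ n ≥ n₀, ∀ m : ℕ, m ≤ 2 ^ ((Nat.log 2 n + c) ^ c) → ∀ f : MvPolynomial (Fin n × Fin n) ℂ, (∀ s ∈ f.support, ∃ ρ : Equiv.Perm (Fin n), s = ∑ i, Finsupp.single (ρ i, i) 1) → coeffVec f ∈ zariskiClosure (coeffVec '' {g : MvPolynomial (Fin n × Fin n) ℂ | ∃ A : Matrix (Fin m) (Fin m) (MvPolynomial (Fin n × Fin n) ℂ), (∀ i j, (A i j).totalDegree ≤ 1) ∧ MvPolynomial.homogeneousComponent n A.det = g}) → ∃ m' : ℕ, m' ≤ 2 ^ ((Nat.log 2 n + c') ^ c') ∧ coeffVec f ∈ zariskiClosure (coeffVec '' {g : MvPolynomial (Fin n × Fin n) ℂ | HasEquivariantDetRepr (Subgroup.closure {γ : Matrix.GeneralLinearGroup (Fin n × Fin n) ℂ | ∃ d e : Fin n → ℂ, (γ : Matrix (Fin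 n × Fin n) (Fin n × Fin n) ℂ) = Matrix.diagonal (fun p => d p.1 * e p.2)}) g m'}))
    (hLB : ∀ c : ℕ, ∃ n₀ : ℕ, ∀ n ≥ n₀, ∀ m : ℕ, m ≤ 2 ^ ((Nat.log 2 n + c) ^ c) → coeffVec (perPoly (Fin n) ℂ) ∉ zariskiClosure (coeffVec '' {g : MvPolynomial (Fin n × Fin n) ℂ | HasEquivariantDetRepr (Subgroup.closure {γ : Matrix.GeneralLinearGroup (Fin n × Fin n) ℂ | ∃ d e : Fin n → ℂ, (γ : Matrix (Fin n × Fin n) (Fin n × Fin n) ℂ) = Matrix.diagonal (fun p => d p.1 * e p.2)}) g m})) :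
    Theses.UnpaddedGIT.InvariantSeparationQP := by
  intro c
  obtain ⟨c', n₁, h₁⟩ := hSym c
  obtain ⟨n₂, h₂⟩ := hLB c'
  refine ⟨max n₁ n₂, fun n hn m hm => ?_⟩
  -- geometric separation in the window, by modus tollens through the torus-equivariant family
  have hsep : coeffVec (perPoly (Fin n) ℂ) ∉ zariskiClosure (coeffVec ''
      {g : MvPolynomial (Fin n × Fin n) ℂ | ∃ A : Matrix (Fin m) (Fin m) (MvPolynomial (Fin n × Fin n) ℂ),
        (∀ i j, (A i j).totalDegree ≤ 1) ∧ MvPolynomial.homogeneousComponent n A.det = g}) := by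
    intro hmem
    obtain ⟨m', hm', hmem'⟩ :=
      h₁ n (le_of_max_le_left hn) m hm (perPoly (Fin n) ℂ) (perPoly_support_perm n) hmem
    exact h₂ n (le_of_max_le_right hn) m' hm' hmem'
  -- GIT completeness: polystability of `per_n` + Mumford separation turn it into the invariant
  have hC := completeness_proof
  unfold Theses.UnpaddedGIT.Completeness at hC
  exact hC n (BurgisserIkenmeyer2017_polystable_det_per_holds.perPoly_closure_subset n)
    (mumford_separation_forms_fin MumfordFogartyKirwan1994_separation_forms_holds n) m hsep

/-- The crux implies the geometric separation it certifies: an invariant vanishing on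
`coeffVec '' D_m(n)` vanishes on its Zariski closure (`Z(I(S)) ∋ x` means every polynomial
vanishing on `S` vanishes at `x`), and it does not vanish at `per_n`. [folklore] -/
theorem not_mem_zariskiClosure_pencil_of_invariantSeparationQP
    (hX : Theses.UnpaddedGIT.InvariantSeparationQP) :
    ∀ c : ℕ, ∃ n₀ : ℕ, ∀ n ≥ n₀, ∀ m : ℕ, m ≤ 2 ^ ((Nat.log 2 n + c) ^ c) → coeffVec (perPoly (Fin n) ℂ) ∉ zariskiClosure (coeffVec '' {g : MvPolynomial (Fin n × Fin n) ℂ | ∃ A : Matrix (Fin m) (Fin m) (MvPolynomial (Fin n × Fin n) ℂ), (∀ i j, (A i j).totalDegree ≤ 1) ∧ MvPolynomial.homogeneousComponent n A.det = g}) := by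
  intro c
  obtain ⟨n₀, hn₀⟩ := hX c
  refine ⟨n₀, fun n hn m hm hmem => ?_⟩
  obtain ⟨F, -, hvan, hper⟩ := hn₀ n hn m hm
  rw [mem_zariskiClosure_iff] at hmem
  refine hper (hmem F ?_)
  rintro _ ⟨g, ⟨A, hA, rfl⟩, rfl⟩
  exact hvan A hA

/-- Restricting a polynomial in the coefficients to the degree-`n` coordinates: substitute `0`
for every coordinate `X_d` with `|d| ≠ n`. Evaluating the restriction at `coeffVec g` is
evaluating the original at `coeffVec (hc_n g)`. [folklore] -/
theorem aeval_coeffVec_restrictDeg {σ : Type*} (n : ℕ) (F : MvPolynomial (σ →₀ ℕ) ℂ)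
    (g : MvPolynomial σ ℂ) :
    aeval (coeffVec g)
        (aeval (fun d : σ →₀ ℕ => if d.degree = n then (X d : MvPolynomial (σ →₀ ℕ) ℂ) else 0) F) =
      aeval (coeffVec (homogeneousComponent n g)) F := by
  rw [← AlgHom.comp_apply]
  congr 1
  refine MvPolynomial.algHom_ext fun d => ?_
  simp only [AlgHom.comp_apply, aeval_X]
  split_ifs with hd
  · rw [aeval_X, coeffVec_apply, coeffVec_apply, coeff_homogeneousComponent, if_pos hd]
  · rw [map_zero, coeffVec_apply, coeff_homogeneousComponent, if_neg hd]

/-- Piece 2 is a consequence of the crux: restrict the separating invariant `F` to the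
degree-`n` coordinates; the restriction agrees with `F` at homogeneous degree-`n` forms (so it is
nonzero at `per_n`) and at `coeffVec (det A)` it equals `F (coeffVec (hc_n det A)) = 0` for EVERY
affine `A`, equivariant or not. [folklore] -/
theorem torusEquivariantBorderQP_of_invariantSeparationQP
    (hX : Theses.UnpaddedGIT.InvariantSeparationQP) :
    ∀ c : ℕ, ∃ n₀ : ℕ, ∀ n ≥ n₀, ∀ m : ℕ, m ≤ 2 ^ ((Nat.log 2 n + c) ^ c) → coeffVec (perPoly (Fin n) ℂ) ∉ zariskiClosure (coeffVec '' {g : MvPolynomial (Fin n × Fin n) ℂ | HasEquivariantDetRepr (Subgroup.closure {γ : Matrix.GeneralLinearGroup (Fin n × Fin n) ℂ | ∃ d e : Fin n → ℂ, (γ : Matrix (Fin n × Fin n) (Fin n × Fin n) ℂ) = Matrix.diagonal (fun p => d p.1 * e p.2)}) g m}) := by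
  intro c
  obtain ⟨n₀, hn₀⟩ := hX c
  refine ⟨n₀, fun n hn m hm hmem => ?_⟩
  obtain ⟨F, -, hvan, hper⟩ := hn₀ n hn m hm
  -- the restricted invariant
  set F' : MvPolynomial ((Fin n × Fin n) →₀ ℕ) ℂ :=
    aeval (fun d : (Fin n × Fin n) →₀ ℕ =>
      if d.degree = n then (X d : MvPolynomial ((Fin n × Fin n) →₀ ℕ) ℂ) else 0) F with hF'
  have hhom : (perPoly (Fin n) ℂ).IsHomogeneous n := by
    simpa using perPoly_isHomogeneous (n := Fin n) (k := ℂ)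
  rw [mem_zariskiClosure_iff] at hmem
  have h0 : aeval (coeffVec (perPoly (Fin n) ℂ)) F' = 0 := by
    refine hmem F' ?_
    rintro _ ⟨g, ⟨A, hA⟩, rfl⟩
    rw [hF', aeval_coeffVec_restrictDeg, ← hA.isAffineDetRepr.2]
    exact hvan A hA.isAffineDetRepr.1
  rw [hF', aeval_coeffVec_restrictDeg, homogeneousComponent_eq_self hhom] at h0
  exact hper h0

end Summit.ValiantsHypothesis.ValiantsHypothesis.Theorems
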